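import Summits.ResolutionOfSingularities.ResolutionOfSingularities.Theorems.PurelyInseparableDim4ScopeDynamics
import Summits.ResolutionOfSingularities.ResolutionOfSingularities.Theorems.PurelyInseparableDim4WildConesLetter
import HarnessLib

/-!
# [OURS · res-dim4-pi · F4-C] SCOPE DYNAMICS, part 3: the TWO-LETTER form `(Φ_C, Φ_I)_lex` of the reduction,
  glued with p-12's Milnor letter at `(p, q) = (2, 2)`

Cell `res-dim4-pi` (D-0157 DOOR 2, wave 2), seat `res-dim4-p-6`, desk WORD #31 (c) R3; sequel of
`PurelyInseparableDim4ScopeDynamics` (one letter: `no_inScope_branch_of_rank`) and of p-12's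
`PurelyInseparableDim4WildConesLetter` (`WildConesBridge.milnor_lt_of_stepRule_two`: along ANY permissible
rule the Milnor number `μ(s) = dim_K K⟦x⟧/(∂F)` strictly drops on edges between ISOLATED `2`-fold states).

* §1 (pure logic) **`no_inScope_branch_of_two_letters`**: a class `A` of states (think: isolated), a letter
  `Ψ` into a well-founded preorder strictly decreasing on in-scope edges INSIDE `A`, and a letter `Φ` into a
  well-order that never increases on in-scope edges, pays (strictly drops) on the TRANSLATED in-scope edges not
  inside `A`, and pays on the EXIT edges `A → ¬A` — then a spine-terminating rule has no infinite in-scope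
  branch (after `Φ` is constant the branch either stays in `A` for ever, against `Ψ`, or avoids `A`, and then
  all its edges are spine, against spine termination).  `no_inScope_branch_of_two_letters'`: the same with
  ENTRY edges `¬A → A` paying instead of exits.  This is the gluing hypothesis the lex letter needs (part 1
  left it untyped).
* §2 (`p = q = 2`, `A = IsIsolated 2`, `Ψ = μ`): **`no_inScope_branch_two_of_letter`** /
  **`terminatesInScope_two_two_of_letter`** / `terminatesInScope_two_two_of_letter_ruleS` — F4-C(2,2) follows
  from ONE well-ordered letter `Φ_C` per field that never increases on in-scope edges of a permissible
  spine-terminating rule (resp. of MODE S), pays on its translated in-scope edges with a NON-ISOLATED endpoint,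
  and pays on its isolated → non-isolated in-scope edges (or, primed versions, on non-isolated → isolated ones).
  The isolated ↔ isolated edges are paid by `μ` (F4-I(2,2) engine, p-12), the all-spine tails by F4-S (p-11).

No letter `Φ_C` is asserted here.  [OURS · counted 0 · elementary; AI kernel work, weaker than expert review.]
NOTHING here is a statement about resolution of singularities; resolution in dimension `≥ 4` / characteristic
`p > 0` is NOT proved by anything in this file.  bears_on: LADDER-RESOLUTION:D157-DOOR2 (res-dim4-pi · F4-C
SCOPE DYNAMICS R3).  Host item (DR-157-C): `stmt-ResolutionOfSingularities-16155`.
-/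

noncomputable section

set_option linter.dupNamespace false -- mandated namespace of this single-conjunct summit

open MvPolynomial

namespace Summit.ResolutionOfSingularities.ResolutionOfSingularities.Theorems.PIDim4

namespace ScopeDynamics

open Literature.AlgebraicGeometry.Resolution
open Literature.AlgebraicGeometry.Resolution.CentreBlowup

variable {K : Type} [Field K] [DecidableEq K]

/-! ## §1 Two letters glued lexicographically (pure logic) -/

/-- **Two-letter reduction, exits pay.**  `R` spine-terminating; `Φ` (well-order) never increases on in-scope
`R`-edges, strictly decreases on translated in-scope edges not inside the class `A` and on exit edges
`A → ¬A`; `Ψ` (well-founded) strictly decreases on in-scope edges inside `A`.  Then `R` has no infinite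
in-scope branch. [folklore] -/
theorem no_inScope_branch_of_two_letters {W : Type} [LinearOrder W] [WellFoundedLT W]
    {V : Type} [Preorder V] [WellFoundedLT V] (q : ℕ) (R : CentreRule K) (hRS : SpineTerminatesUnder q R)
    (A : State K → Prop) (Φ : State K → W) (Ψ : State K → V)
    (hle : ∀ s s' : State K, InCoordinateScope q s.F → InCoordinateScope q s'.F → StepRule q R s s' → Φ s' ≤ Φ s)
    (hlt : ∀ s s' : State K, InCoordinateScope q s.F → InCoordinateScope q s'.F → StepRule q R s s' →
      ¬ SpineEdge q (R s) s s' → ¬ (A s ∧ A s') → Φ s' < Φ s)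
    (hexit : ∀ s s' : State K, InCoordinateScope q s.F → InCoordinateScope q s'.F → StepRule q R s s' →
      A s → ¬ A s' → Φ s' < Φ s)
    (hA : ∀ s s' : State K, InCoordinateScope q s.F → InCoordinateScope q s'.F → StepRule q R s s' →
      A s → A s' → Ψ s' < Ψ s) :
    ¬ ∃ c : ℕ → State K, ∀ k, InCoordinateScope q (c k).F ∧ StepRule q R (c k) (c (k + 1)) := by
  rintro ⟨c, hc⟩
  have hmono : ∀ k, Φ (c (k + 1)) ≤ Φ (c k) := fun k => hle _ _ (hc k).1 (hc (k + 1)).1 (hc k).2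
  obtain ⟨T, hT⟩ := IsolatedMeasure.eventually_const_of_succ_le (fun k => Φ (c k)) hmono
  -- beyond `T` the letter `Φ` is constant, so no paying edge occurs
  have hconst : ∀ k, T ≤ k → ¬ Φ (c (k + 1)) < Φ (c k) := fun k hk h => by
    have h1 : Φ (c k) = Φ (c T) := hT k hk
    have h2 : Φ (c (k + 1)) = Φ (c T) := hT (k + 1) (by omega)
    rw [h1, h2] at h
    exact lt_irrefl _ h
  by_cases hex : ∃ k, T ≤ k ∧ A (c k)
  · -- the branch enters `A` after `T` and can never leave: `Ψ` descends for ever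
    obtain ⟨k₀, hk₀, hA₀⟩ := hex
    have hall : ∀ m, A (c (k₀ + m)) := fun m => by
      induction m with
      | zero => simpa using hA₀
      | succ m ih =>
        by_contra hnot
        rw [← Nat.add_assoc] at hnot
        exact hconst (k₀ + m) (by omega)
          (hexit _ _ (hc (k₀ + m)).1 (hc (k₀ + m + 1)).1 (hc (k₀ + m)).2 ih hnot)
    refine not_strictAnti_of_wellFoundedLT (fun m => Ψ (c (k₀ + m))) (strictAnti_nat_of_succ_lt fun m => ?_)
    have h := hA _ _ (hc (k₀ + m)).1 (hc (k₀ + m + 1)).1 (hc (k₀ + m)).2 (hall m)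
      (by have := hall (m + 1); rwa [← Nat.add_assoc] at this)
    show Ψ (c (k₀ + (m + 1))) < Ψ (c (k₀ + m))
    rwa [← Nat.add_assoc]
  · -- the branch avoids `A` after `T`: every edge is spine, against spine termination
    push Not at hex
    obtain ⟨k, hk, hnot⟩ := exists_translated_of_branch q R hRS c (fun k => (hc k).2) T
    exact hconst k hk (hlt _ _ (hc k).1 (hc (k + 1)).1 (hc k).2 hnot fun h => hex k hk h.1)

/-- **Two-letter reduction, entries pay** (the variant with the entry edges `¬A → A` paying instead of the
exits). [folklore] -/
theorem no_inScope_branch_of_two_letters' {W : Type} [LinearOrder W] [WellFoundedLT W]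
    {V : Type} [Preorder V] [WellFoundedLT V] (q : ℕ) (R : CentreRule K) (hRS : SpineTerminatesUnder q R)
    (A : State K → Prop) (Φ : State K → W) (Ψ : State K → V)
    (hle : ∀ s s' : State K, InCoordinateScope q s.F → InCoordinateScope q s'.F → StepRule q R s s' → Φ s' ≤ Φ s)
    (hlt : ∀ s s' : State K, InCoordinateScope q s.F → InCoordinateScope q s'.F → StepRule q R s s' →
      ¬ SpineEdge q (R s) s s' → ¬ (A s ∧ A s') → Φ s' < Φ s)
    (hentry : ∀ s s' : State K, InCoordinateScope q s.F → InCoordinateScope q s'.F → StepRule q R s s' →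
      ¬ A s → A s' → Φ s' < Φ s)
    (hA : ∀ s s' : State K, InCoordinateScope q s.F → InCoordinateScope q s'.F → StepRule q R s s' →
      A s → A s' → Ψ s' < Ψ s) :
    ¬ ∃ c : ℕ → State K, ∀ k, InCoordinateScope q (c k).F ∧ StepRule q R (c k) (c (k + 1)) := by
  rintro ⟨c, hc⟩
  have hmono : ∀ k, Φ (c (k + 1)) ≤ Φ (c k) := fun k => hle _ _ (hc k).1 (hc (k + 1)).1 (hc k).2
  obtain ⟨T, hT⟩ := IsolatedMeasure.eventually_const_of_succ_le (fun k => Φ (c k)) hmono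
  have hconst : ∀ k, T ≤ k → ¬ Φ (c (k + 1)) < Φ (c k) := fun k hk h => by
    have h1 : Φ (c k) = Φ (c T) := hT k hk
    have h2 : Φ (c (k + 1)) = Φ (c T) := hT (k + 1) (by omega)
    rw [h1, h2] at h
    exact lt_irrefl _ h
  by_cases hex : ∃ k, T ≤ k ∧ ¬ A (c k)
  · -- the branch leaves `A` after `T` and can never re-enter: every later edge is spine
    obtain ⟨k₀, hk₀, hA₀⟩ := hex
    have hall : ∀ m, ¬ A (c (k₀ + m)) := fun m => by
      induction m with
      | zero => simpa using hA₀
      | succ m ih =>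
        intro hin
        rw [← Nat.add_assoc] at hin
        exact hconst (k₀ + m) (by omega)
          (hentry _ _ (hc (k₀ + m)).1 (hc (k₀ + m + 1)).1 (hc (k₀ + m)).2 ih hin)
    obtain ⟨k, hk, hnot⟩ := exists_translated_of_branch q R hRS c (fun k => (hc k).2) k₀
    obtain ⟨m, rfl⟩ := Nat.exists_eq_add_of_le hk
    exact hconst (k₀ + m) (by omega)
      (hlt _ _ (hc (k₀ + m)).1 (hc (k₀ + m + 1)).1 (hc (k₀ + m)).2 hnot fun h => hall m h.1)
  · -- the branch stays in `A` after `T`: `Ψ` descends for ever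
    push Not at hex
    refine not_strictAnti_of_wellFoundedLT (fun m => Ψ (c (T + m))) (strictAnti_nat_of_succ_lt fun m => ?_)
    have h := hA _ _ (hc (T + m)).1 (hc (T + m + 1)).1 (hc (T + m)).2 (hex (T + m) (by omega))
      (hex (T + m + 1) (by omega))
    show Ψ (c (T + (m + 1))) < Ψ (c (T + m))
    rwa [← Nat.add_assoc]

/-! ## §2 `(p, q) = (2, 2)`: the isolated edges are paid by the Milnor number -/

section TwoTwo

variable [CharP K 2]

/-- **F4-C(2,2), single field, two letters**: a permissible spine-terminating rule `R` over a field of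
characteristic `2` with a well-ordered letter `Φ` that never increases on in-scope `R`-edges, strictly
decreases on the translated in-scope edges with a non-isolated endpoint and on the isolated → non-isolated
in-scope edges, has no infinite in-scope branch — the isolated → isolated edges are paid by p-12's Milnor
letter (`WildConesBridge.milnor_lt_of_stepRule_two`). [folklore] -/
theorem no_inScope_branch_two_of_letter {W : Type} [LinearOrder W] [WellFoundedLT W] (R : CentreRule K)
    (hR : IsPermissibleRule 2 R) (hRS : SpineTerminatesUnder 2 R) (Φ : State K → W)
    (hle : ∀ s s' : State K, InCoordinateScope 2 s.F → InCoordinateScope 2 s'.F → StepRule 2 R s s' → Φ s' ≤ Φ s)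
    (hlt : ∀ s s' : State K, InCoordinateScope 2 s.F → InCoordinateScope 2 s'.F → StepRule 2 R s s' →
      ¬ SpineEdge 2 (R s) s s' → ¬ (IsIsolated 2 s.F ∧ IsIsolated 2 s'.F) → Φ s' < Φ s)
    (hexit : ∀ s s' : State K, InCoordinateScope 2 s.F → InCoordinateScope 2 s'.F → StepRule 2 R s s' →
      IsIsolated 2 s.F → ¬ IsIsolated 2 s'.F → Φ s' < Φ s) :
    ¬ ∃ c : ℕ → State K, ∀ k, InCoordinateScope 2 (c k).F ∧ StepRule 2 R (c k) (c (k + 1)) :=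
  no_inScope_branch_of_two_letters 2 R hRS (fun s => IsIsolated 2 s.F) Φ
    (fun s : State K => Module.finrank K (MvPowerSeries (Fin 4) K ⧸ Ideal.span (Set.range fun t : Fin 4 =>
      MvPowerSeries.pderiv t ((s.F : MvPolynomial (Fin 4) K) : MvPowerSeries (Fin 4) K))))
    hle hlt hexit fun _ _ _ _ hst hs hs' => WildConesBridge.milnor_lt_of_stepRule_two R hR hs hs' hst

/-- The same with the non-isolated → isolated (ENTRY) edges paying instead of the exits. [folklore] -/
theorem no_inScope_branch_two_of_letter' {W : Type} [LinearOrder W] [WellFoundedLT W] (R : CentreRule K)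
    (hR : IsPermissibleRule 2 R) (hRS : SpineTerminatesUnder 2 R) (Φ : State K → W)
    (hle : ∀ s s' : State K, InCoordinateScope 2 s.F → InCoordinateScope 2 s'.F → StepRule 2 R s s' → Φ s' ≤ Φ s)
    (hlt : ∀ s s' : State K, InCoordinateScope 2 s.F → InCoordinateScope 2 s'.F → StepRule 2 R s s' →
      ¬ SpineEdge 2 (R s) s s' → ¬ (IsIsolated 2 s.F ∧ IsIsolated 2 s'.F) → Φ s' < Φ s)
    (hentry : ∀ s s' : State K, InCoordinateScope 2 s.F → InCoordinateScope 2 s'.F → StepRule 2 R s s' →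
      ¬ IsIsolated 2 s.F → IsIsolated 2 s'.F → Φ s' < Φ s) :
    ¬ ∃ c : ℕ → State K, ∀ k, InCoordinateScope 2 (c k).F ∧ StepRule 2 R (c k) (c (k + 1)) :=
  no_inScope_branch_of_two_letters' 2 R hRS (fun s => IsIsolated 2 s.F) Φ
    (fun s : State K => Module.finrank K (MvPowerSeries (Fin 4) K ⧸ Ideal.span (Set.range fun t : Fin 4 =>
      MvPowerSeries.pderiv t ((s.F : MvPolynomial (Fin 4) K) : MvPowerSeries (Fin 4) K))))
    hle hlt hentry fun _ _ _ _ hst hs hs' => WildConesBridge.milnor_lt_of_stepRule_two R hR hs hs' hst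

end TwoTwo

/-- **F4-C(2,2) FROM ONE LETTER `Φ_C` FOR THE NON-ISOLATED REGIME** (frame form): if over every field of
characteristic `2` some permissible coordinate rule wins the spine game and carries a well-ordered letter that
never increases on its in-scope edges, pays on the translated in-scope edges with a non-isolated endpoint and
on the isolated → non-isolated in-scope edges, then `PIDim4.TerminatesInScope 2 2`. [folklore] -/
theorem terminatesInScope_two_two_of_letter
    (h : ∀ (K : Type) [Field K] [CharP K 2] [DecidableEq K],
      ∃ R : CentreRule K, IsPermissibleRule 2 R ∧ SpineTerminatesUnder 2 R ∧
        ∃ (W : Type) (_ : LinearOrder W) (_ : WellFoundedLT W) (Φ : State K → W),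
          (∀ s s' : State K, InCoordinateScope 2 s.F → InCoordinateScope 2 s'.F → StepRule 2 R s s' →
            Φ s' ≤ Φ s) ∧
          (∀ s s' : State K, InCoordinateScope 2 s.F → InCoordinateScope 2 s'.F → StepRule 2 R s s' →
            ¬ SpineEdge 2 (R s) s s' → ¬ (IsIsolated 2 s.F ∧ IsIsolated 2 s'.F) → Φ s' < Φ s) ∧
          (∀ s s' : State K, InCoordinateScope 2 s.F → InCoordinateScope 2 s'.F → StepRule 2 R s s' →
            IsIsolated 2 s.F → ¬ IsIsolated 2 s'.F → Φ s' < Φ s)) :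
    TerminatesInScope 2 2 := by
  intro K _ _ _
  obtain ⟨R, hR, hRS, W, _, _, Φ, hle, hlt, hexit⟩ := h K
  exact ⟨R, hR, no_inScope_branch_two_of_letter R hR hRS Φ hle hlt hexit⟩

/-- **F4-C(2,2) FROM ONE LETTER FOR MODE S** (the rule of record: p-11's `ruleS 2` is permissible and wins the
spine game). [folklore] -/
theorem terminatesInScope_two_two_of_letter_ruleS
    (h : ∀ (K : Type) [Field K] [CharP K 2] [DecidableEq K],
      ∃ (W : Type) (_ : LinearOrder W) (_ : WellFoundedLT W) (Φ : State K → W),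
        (∀ s s' : State K, InCoordinateScope 2 s.F → InCoordinateScope 2 s'.F →
          StepRule 2 (ruleS 2) s s' → Φ s' ≤ Φ s) ∧
        (∀ s s' : State K, InCoordinateScope 2 s.F → InCoordinateScope 2 s'.F →
          StepRule 2 (ruleS 2) s s' → ¬ SpineEdge 2 (ruleS 2 s) s s' →
            ¬ (IsIsolated 2 s.F ∧ IsIsolated 2 s'.F) → Φ s' < Φ s) ∧
        (∀ s s' : State K, InCoordinateScope 2 s.F → InCoordinateScope 2 s'.F →
          StepRule 2 (ruleS 2) s s' → IsIsolated 2 s.F → ¬ IsIsolated 2 s'.F → Φ s' < Φ s)) :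
    TerminatesInScope 2 2 :=
  terminatesInScope_two_two_of_letter fun K _ _ _ =>
    ⟨ruleS 2, SpineRuleS.isPermissibleRule_ruleS (by norm_num), SpineRuleS.spineTerminatesUnder_ruleS (by norm_num),
      h K⟩

end ScopeDynamics

end Summit.ResolutionOfSingularities.ResolutionOfSingularities.Theorems.PIDim4

end
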